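import Mathlib
import Summits.ValiantsHypothesis.ValiantsHypothesis.Theorems.BarrierLeverPartitionMinorsHitByVPHiddenStatesTwoLayerWitness

/-!
# Route BarrierLever — item `PartitionMinorsHitByVP` (stmt-ValiantsHypothesis-19717), line `hidden-states`:
# STAR JOINS — the conjecture node `stub_universalJoinWide` holds for every `r ≤ 2h(h³+1)` (all `r ≤ 2^h` when `h ≤ 17`)

Helper file (`--supports stmt-ValiantsHypothesis-19717`; cell valiant-natproofs, rung V4, 𝒟-side door (c), registered line
`Cruxes/PartitionMinorsHitByVP/Lines/hidden_states.lean` v2, lane `stub_universalJoinWide`; prover seat val-np-p3 gen 10).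
Bookkeeping `def`s only (`starE`, `starW`, `starWt`, `starTab`: an explicit join family, its threshold weights and a table).
Closes NO item.

THE POINT. The line's conjecture node asks, for `h ≥ h₁` and every `r ≤ 2^h`, for ONE join threshold family
`e : Fin r → Fin m × Finset (Fin K)` (`m ≤ 2h` pieces, `K ≤ h³` states, a strict weight threshold) such that EVERY injective
row family `u : Fin r → Finset (Fin h)` admits a table `tx` with
`det [∏_{a ∈ u i} (tx p none a + Σ_{q ∈ J} tx p (some q) a)]_{i,(p,J) = e k} ≠ 0`.
A piece whose members are only `∅` and singletons `{q}` — a STAR — contributes the points `tx p none` and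
`tx p none + tx p (some q)`, which are FREE: no affine relation ties them. So a join of `m` stars realises up to `m(K+1)`
points in completely general position, and general points are unisolvent for ANY `r` distinct multilinear monomials.
Constructively (`starTab`): send the base point of piece `p` to the indicator vector `1_{u k₀}` of the row matched to it and the
satellite `{q}` to `1_{u k}`; then the block-additive matrix IS the zeta matrix `[u i ⊆ u k]` (`entry_star`), whose kernel is
trivial (`TwoLayer.eq_zero_of_zeta`, val-np-p3 g9), so `det ≠ 0` (`det_star_ne_zero`).

RESULTS.
* `starJoin_good` — for ALL `h m K r` with `r ≤ m(K+1)`: a legal join threshold family (injective, strict threshold: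
  members weigh `≤ 1`, non-members `≥ 2`) good for EVERY injective `u`.
* `universalJoinWide_of_le` — the body of `Stmt.stub_universalJoinWide` for every `h` and every `r ≤ (h+h)(h·h·h+1)`;
  `universalJoinWide_upto_seventeen` — hence for EVERY `r ≤ 2^h` when `1 ≤ h ≤ 17`.
* `qjoinSharp_of_le` — the body of `Stmt.stub_qjoinSharp` (pieces with `h·h` states) for every `r ≤ (h+h)(h·h+1)`;
  `qjoinSharp_upto_eleven` — hence for every `r ≤ 2^h` when `1 ≤ h ≤ 11`.
* `twoSkeleton_within_star_range` — `|B₃(h)| ≤ 1+h+h²+h³ ≤ (h+h)(h·h+1)` (`h ≥ 1`): the 2-skeleton witness that kills the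
  single cube (`TripleRank.not_ballGood_sq_hypothesis`, `…TwoSkeletonWindow`) — and every witness with `r ≤ 2h³+2h`, e.g. all of
  `B₄([h])` — lies inside the star range, so it cannot touch the join stubs (planner g19's ASK, card v2 §UPDATE (ii)).

CONSEQUENCES FOR THE LINE. The conjecture node is open only from `h = 18`, `r ∈ (2h⁴+2h, 2^h]`; `Q_join(h²)` only from
`h = 12`, `r ∈ (3480, 4096]` (where `𝒰` is the 12-cube minus at most 615 sets). Any falsifier must use `r > 2h³+2h`
(members with two or more states are then forced) and must defeat the free points of the star pieces.

WHAT THIS IS NOT: nothing for `r > m(K+1)` (deep members); `stub_universalJoinWide` stays OPEN (it quantifies over all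
`r ≤ 2^h` for all large `h`); item 19717 OPEN; nothing on crux 14610 or VP ≠ VNP.
-/

set_option linter.dupNamespace false

namespace Summit.ValiantsHypothesis.ValiantsHypothesis.Theorems.BarrierLever.HiddenStates

open Finset Matrix

noncomputable section

namespace StarJoin

variable {h m K r : ℕ}

/-! ## 1. The star-join family and its threshold weights -/

/-- The piece of column `k`: `⌊k/(K+1)⌋` (columns are numbered piece by piece, `K+1` per piece). -/
def piece (hr : r ≤ m * (K + 1)) (k : Fin r) : Fin m :=
  ⟨(k : ℕ) / (K + 1), Nat.div_lt_of_lt_mul (by rw [Nat.mul_comm]; exact lt_of_lt_of_le k.2 hr)⟩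

/-- The value of `piece`. -/
@[simp] theorem piece_val (hr : r ≤ m * (K + 1)) (k : Fin r) : (piece hr k : ℕ) = (k : ℕ) / (K + 1) := rfl

/-- The hidden states of column `k`: none (the base point) when `k ≡ 0 (mod K+1)`, else the single state `k % (K+1) − 1`. -/
def states (K : ℕ) (k : Fin r) : Finset (Fin K) :=
  if hk : (k : ℕ) % (K + 1) = 0 then ∅
  else {⟨(k : ℕ) % (K + 1) - 1, by have : (k : ℕ) % (K + 1) < K + 1 := Nat.mod_lt _ (Nat.succ_pos K); omega⟩}

/-- **The star-join family**: `m` pieces, each the star `{∅} ∪ {{q} : q < K}`, filled piece by piece up to `r ≤ m(K+1)`. -/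
def starE (hr : r ≤ m * (K + 1)) (k : Fin r) : Fin m × Finset (Fin K) :=
  (piece hr k, states K k)

/-- Piece weight: `0` for a used piece (its base column `p(K+1)` exists), `2` for an unused one. -/
def starW (K r : ℕ) (p : Fin m) : ℕ := if (p : ℕ) * (K + 1) < r then 0 else 2

/-- State weight: `1` if the satellite column `p(K+1)+q+1` exists, `2` otherwise. -/
def starWt (K r : ℕ) (p : Fin m) (q : Fin K) : ℕ := if (p : ℕ) * (K + 1) + q + 1 < r then 1 else 2

/-- `k = (K+1)⌊k/(K+1)⌋ + (k mod (K+1))`, in the order used below. -/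
theorem div_mul_add_mod (k : ℕ) (K : ℕ) : k / (K + 1) * (K + 1) + k % (K + 1) = k := by
  have := Nat.div_add_mod k (K + 1)
  rw [Nat.mul_comm] at this
  exact this

/-- The star-join family is injective. -/
theorem starE_injective (hr : r ≤ m * (K + 1)) : Function.Injective (starE (m := m) hr) := by
  intro k k' hkk
  have h1 : (k : ℕ) / (K + 1) = (k' : ℕ) / (K + 1) := by
    have := congrArg (fun x => ((x.1 : Fin m) : ℕ)) hkk
    simpa [starE] using this
  have h2 : states K k = states K k' := congrArg Prod.snd hkk
  have h3 : (k : ℕ) % (K + 1) = (k' : ℕ) % (K + 1) := by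
    unfold states at h2
    by_cases hk : (k : ℕ) % (K + 1) = 0 <;> by_cases hk' : (k' : ℕ) % (K + 1) = 0
    · rw [hk, hk']
    · rw [dif_pos hk, dif_neg hk'] at h2; exact absurd h2.symm (Finset.singleton_ne_empty _)
    · rw [dif_neg hk, dif_pos hk'] at h2; exact absurd h2 (Finset.singleton_ne_empty _)
    · rw [dif_neg hk, dif_neg hk'] at h2
      have := congrArg (fun x : Fin K => (x : ℕ)) (Finset.singleton_injective h2)
      simp only at this
      omega
  apply Fin.ext
  rw [← div_mul_add_mod (k : ℕ) K, ← div_mul_add_mod (k' : ℕ) K, h1, h3]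

/-- The base column of a used piece. -/
theorem starE_base (hr : r ≤ m * (K + 1)) (p : Fin m) (hp : (p : ℕ) * (K + 1) < r) :
    starE hr ⟨(p : ℕ) * (K + 1), hp⟩ = (p, ∅) := by
  unfold starE piece states
  ext1
  · apply Fin.ext
    simp
  · simp

/-- The satellite column of an existing satellite. -/
theorem starE_sat (hr : r ≤ m * (K + 1)) (p : Fin m) (q : Fin K) (hq : (p : ℕ) * (K + 1) + q + 1 < r) :
    starE hr ⟨(p : ℕ) * (K + 1) + q + 1, hq⟩ = (p, {q}) := by
  unfold starE piece states
  have hq1 : ((q : ℕ) + 1) % (K + 1) = q + 1 := Nat.mod_eq_of_lt (by omega)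
  have hmod : ((p : ℕ) * (K + 1) + q + 1) % (K + 1) = q + 1 := by
    rw [Nat.add_assoc, Nat.mul_add_mod', hq1]
  have hdiv : ((p : ℕ) * (K + 1) + q + 1) / (K + 1) = p := by
    rw [Nat.add_assoc, Nat.mul_comm, Nat.mul_add_div (Nat.succ_pos K), Nat.div_eq_of_lt (by omega), Nat.add_zero]
  ext1
  · apply Fin.ext
    simp [hdiv]
  · simp [hmod]

/-- Members weigh at most `1`. -/
theorem weight_member_le (hr : r ≤ m * (K + 1)) (i : Fin r) :
    starW K r (starE hr i).1 + ∑ k ∈ (starE hr i).2, starWt K r (starE hr i).1 k ≤ 1 := by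
  have hi := i.2
  have hdm := div_mul_add_mod (i : ℕ) K
  have hbase : ((i : ℕ) / (K + 1)) * (K + 1) < r := by omega
  have hW : starW K r (starE hr i).1 = 0 := by
    simp only [starE, starW, piece_val, hbase, if_true]
  rw [hW, zero_add]
  simp only [starE, states]
  by_cases h0 : (i : ℕ) % (K + 1) = 0
  · simp [h0]
  · rw [dif_neg h0, Finset.sum_singleton]
    simp only [starWt, piece_val]
    rw [if_pos]
    omega

/-- Non-members weigh at least `2`. -/
theorem two_le_weight_nonmember (hr : r ≤ m * (K + 1)) (x : Fin m × Finset (Fin K))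
    (hx : x ∉ Set.range (starE hr)) : 2 ≤ starW K r x.1 + ∑ k ∈ x.2, starWt K r x.1 k := by
  obtain ⟨p, J⟩ := x
  simp only
  by_cases hp : (p : ℕ) * (K + 1) < r
  · -- used piece: the base and the existing satellites are members, everything else weighs ≥ 2
    have hW : starW K r p = 0 := by simp [starW, hp]
    rw [hW, zero_add]
    have hone : ∀ k ∈ J, 1 ≤ starWt K r p k := fun k _ => by unfold starWt; split_ifs <;> omega
    have hcard : J.card ≤ ∑ k ∈ J, starWt K r p k := by
      have := Finset.card_nsmul_le_sum J (starWt K r p) 1 hone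
      simpa using this
    rcases Nat.lt_or_ge J.card 2 with hlt | hge
    · rcases Nat.lt_or_ge J.card 1 with h0 | h1
      · -- J = ∅: the base column
        have hJ : J = ∅ := Finset.card_eq_zero.mp (by omega)
        exact absurd ⟨⟨(p : ℕ) * (K + 1), hp⟩, by rw [starE_base hr p hp, hJ]⟩ hx
      · -- J = {q}
        obtain ⟨q, hJ⟩ := Finset.card_eq_one.mp (show J.card = 1 by omega)
        subst hJ
        rw [Finset.sum_singleton]
        unfold starWt
        by_cases hq : (p : ℕ) * (K + 1) + q + 1 < r
        · exact absurd ⟨⟨(p : ℕ) * (K + 1) + q + 1, hq⟩, starE_sat hr p q hq⟩ hx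
        · rw [if_neg hq]
    · exact le_trans hge hcard
  · have hW : starW K r p = 2 := by simp [starW, hp]
    rw [hW]
    omega

/-- **The star-join family is a strict threshold family** (the hypothesis of the join doors). -/
theorem star_threshold (hr : r ≤ m * (K + 1)) :
    ∀ x : Fin m × Finset (Fin K), x ∉ Set.range (starE hr) →
      ∀ i, starW K r (starE hr i).1 + ∑ k ∈ (starE hr i).2, starWt K r (starE hr i).1 k
        < starW K r x.1 + ∑ k ∈ x.2, starWt K r x.1 k :=
  fun x hx i => lt_of_le_of_lt (weight_member_le hr i) (lt_of_lt_of_le one_lt_two (two_le_weight_nonmember hr x hx))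

/-! ## 2. The indicator table: the block-additive matrix is the zeta matrix of `u` -/

/-- **The indicator table** for a row family `u`: the base point of piece `p` is the indicator vector of row `p(K+1)`,
the satellite `{q}` is moved to the indicator vector of row `p(K+1)+q+1` (zero outside the used range). -/
def starTab (K r : ℕ) (u : Fin r → Finset (Fin h)) (p : Fin m) : Option (Fin K) → Fin h → ℂ
  | none => fun a => if hp : (p : ℕ) * (K + 1) < r then (if a ∈ u ⟨(p : ℕ) * (K + 1), hp⟩ then 1 else 0) else 0
  | some q => fun a => if hq : (p : ℕ) * (K + 1) + q + 1 < r then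
      (if a ∈ u ⟨(p : ℕ) * (K + 1) + q + 1, hq⟩ then 1 else 0) -
        (if a ∈ u ⟨(p : ℕ) * (K + 1), by omega⟩ then 1 else 0) else 0

/-- The point of column `k` is the indicator vector of `u k`. -/
theorem lin_starTab (hr : r ≤ m * (K + 1)) (u : Fin r → Finset (Fin h)) (k : Fin r) (a : Fin h) :
    starTab K r u (starE hr k).1 none a + ∑ q ∈ (starE hr k).2, starTab K r u (starE hr k).1 (some q) a
      = if a ∈ u k then 1 else 0 := by
  have hk := k.2
  have hdm := div_mul_add_mod (k : ℕ) K
  have hbase : ((k : ℕ) / (K + 1)) * (K + 1) < r := by omega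
  simp only [starE, states]
  by_cases h0 : (k : ℕ) % (K + 1) = 0
  · -- base column: k = p(K+1)
    rw [dif_pos h0, Finset.sum_empty, add_zero]
    have hkeq : (⟨((k : ℕ) / (K + 1)) * (K + 1), hbase⟩ : Fin r) = k := by
      apply Fin.ext; simp only; omega
    simp only [starTab, piece_val, hbase, dif_pos, hkeq]
  · -- satellite column: k = p(K+1) + q + 1
    rw [dif_neg h0, Finset.sum_singleton]
    have hsat : ((k : ℕ) / (K + 1)) * (K + 1) + ((k : ℕ) % (K + 1) - 1) + 1 < r := by omega
    have hkeq : (⟨((k : ℕ) / (K + 1)) * (K + 1) + ((k : ℕ) % (K + 1) - 1) + 1, hsat⟩ : Fin r) = k := by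
      apply Fin.ext; simp only; omega
    simp only [starTab, piece_val, hbase, dif_pos, hsat, hkeq]
    ring

/-- **Zeta entries**: the `(i,k)` entry of the block-additive matrix for the indicator table is `[u i ⊆ u k]`. -/
theorem entry_star (hr : r ≤ m * (K + 1)) (u : Fin r → Finset (Fin h)) (i k : Fin r) :
    ∏ a ∈ u i, (starTab K r u (starE hr k).1 none a + ∑ q ∈ (starE hr k).2, starTab K r u (starE hr k).1 (some q) a)
      = if u i ⊆ u k then 1 else 0 := by
  simp_rw [lin_starTab hr u k]
  rw [Finset.prod_boole]
  by_cases hsub : u i ⊆ u k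
  · rw [if_pos hsub, if_pos (fun a ha => hsub ha)]
  · rw [if_neg hsub, if_neg (fun hall => hsub (fun a ha => hall a ha))]

/-- **The star join is good for every injective row family**: the zeta matrix is nonsingular. -/
theorem det_star_ne_zero (hr : r ≤ m * (K + 1)) (u : Fin r → Finset (Fin h)) (hu : Function.Injective u) :
    (Matrix.of fun i k : Fin r => ∏ a ∈ u i,
      (starTab K r u (starE hr k).1 none a + ∑ q ∈ (starE hr k).2, starTab K r u (starE hr k).1 (some q) a)).det ≠ 0 := by
  classical
  intro hdet
  obtain ⟨α, hαne, hαmul⟩ := Matrix.exists_mulVec_eq_zero_iff.mpr hdet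
  apply hαne
  let col : Fin r → (Fin r → ℂ) := fun k i => ∏ a ∈ u i,
    (starTab K r u (starE hr k).1 none a + ∑ q ∈ (starE hr k).2, starTab K r u (starE hr k).1 (some q) a)
  have hzeta : ∀ k ∈ (Finset.univ : Finset (Fin r)), ∀ k' ∈ (Finset.univ : Finset (Fin r)),
      col k' (id k) = if u k ⊆ u k' then 1 else 0 := fun k _ k' _ => entry_star hr u k k'
  have hsum : ∑ k, α k • col k = 0 := by
    funext i
    have := congrFun hαmul i
    rw [Matrix.mulVec, dotProduct] at this
    simp only [Matrix.of_apply, Pi.zero_apply] at this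
    rw [Finset.sum_apply, Pi.zero_apply]
    simpa [col, Pi.smul_apply, smul_eq_mul, mul_comm] using this
  funext k
  exact TwoLayer.eq_zero_of_zeta u hu col Finset.univ id hzeta α (fun k hk => absurd (Finset.mem_univ k) hk) hsum k

/-! ## 3. Packaged statements -/

/-- **STAR-JOIN THEOREM.** For every `h, m, K` and every `r ≤ m(K+1)` there is a legal join threshold family with `m` pieces of
`K` states (the star join) against which EVERY injective row family on `Fin h` has a nonsingular block-additive matrix. -/
theorem starJoin_good (h m K r : ℕ) (hr : r ≤ m * (K + 1)) :
    ∃ (W : Fin m → ℕ) (wt : Fin m → Fin K → ℕ) (e : Fin r → Fin m × Finset (Fin K)),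
      Function.Injective e ∧
      (∀ x : Fin m × Finset (Fin K), x ∉ Set.range e →
        ∀ i, W (e i).1 + ∑ k ∈ (e i).2, wt (e i).1 k < W x.1 + ∑ k ∈ x.2, wt x.1 k) ∧
      ∀ u : Fin r → Finset (Fin h), Function.Injective u →
        ∃ tx : Fin m → Option (Fin K) → Fin h → ℂ,
          (Matrix.of fun i k : Fin r =>
            ∏ a ∈ u i, (tx (e k).1 none a + ∑ q ∈ (e k).2, tx (e k).1 (some q) a)).det ≠ 0 :=
  ⟨starW K r, starWt K r, starE hr, starE_injective hr, star_threshold hr,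
    fun u hu => ⟨starTab K r u, det_star_ne_zero hr u hu⟩⟩

/-- **The conjecture node below `2h(h³+1)`**: the body of `Stmt.stub_universalJoinWide` (line `hidden-states`) holds for
every `h` and every `r ≤ (h+h)(h·h·h+1)` — `2h` star pieces with `h³` states each. -/
theorem universalJoinWide_of_le (h r : ℕ) (hr : r ≤ (h + h) * (h * h * h + 1)) :
    ∃ (m K : ℕ) (W : Fin m → ℕ) (wt : Fin m → Fin K → ℕ) (e : Fin r → Fin m × Finset (Fin K)),
      m ≤ h + h ∧ K ≤ h * h * h ∧ Function.Injective e ∧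
      (∀ x : Fin m × Finset (Fin K), x ∉ Set.range e →
        ∀ i, W (e i).1 + ∑ k ∈ (e i).2, wt (e i).1 k < W x.1 + ∑ k ∈ x.2, wt x.1 k) ∧
      ∀ u : Fin r → Finset (Fin h), Function.Injective u →
        ∃ tx : Fin m → Option (Fin K) → Fin h → ℂ,
          (Matrix.of fun i k : Fin r =>
            ∏ a ∈ u i, (tx (e k).1 none a + ∑ q ∈ (e k).2, tx (e k).1 (some q) a)).det ≠ 0 := by
  obtain ⟨W, wt, e, he, hthr, hgood⟩ := starJoin_good h (h + h) (h * h * h) r hr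
  exact ⟨h + h, h * h * h, W, wt, e, le_rfl, le_rfl, he, hthr, hgood⟩

/-- `2^h ≤ 2h(h³+1)` for `1 ≤ h ≤ 17` (and not for `h = 18`). -/
theorem two_pow_le_star_range (h : ℕ) (h1 : 1 ≤ h) (h17 : h ≤ 17) : 2 ^ h ≤ (h + h) * (h * h * h + 1) := by
  interval_cases h <;> norm_num

/-- **The conjecture node for `h ≤ 17`**: for `1 ≤ h ≤ 17` the body of `Stmt.stub_universalJoinWide` holds for EVERY `r ≤ 2^h`.
So the node is open only from `h = 18` (`r ∈ (2h⁴+2h, 2^h]`). -/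
theorem universalJoinWide_upto_seventeen (h : ℕ) (h1 : 1 ≤ h) (h17 : h ≤ 17) (r : ℕ) (hr : r ≤ 2 ^ h) :
    ∃ (m K : ℕ) (W : Fin m → ℕ) (wt : Fin m → Fin K → ℕ) (e : Fin r → Fin m × Finset (Fin K)),
      m ≤ h + h ∧ K ≤ h * h * h ∧ Function.Injective e ∧
      (∀ x : Fin m × Finset (Fin K), x ∉ Set.range e →
        ∀ i, W (e i).1 + ∑ k ∈ (e i).2, wt (e i).1 k < W x.1 + ∑ k ∈ x.2, wt x.1 k) ∧
      ∀ u : Fin r → Finset (Fin h), Function.Injective u →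
        ∃ tx : Fin m → Option (Fin K) → Fin h → ℂ,
          (Matrix.of fun i k : Fin r =>
            ∏ a ∈ u i, (tx (e k).1 none a + ∑ q ∈ (e k).2, tx (e k).1 (some q) a)).det ≠ 0 :=
  universalJoinWide_of_le h r (hr.trans (two_pow_le_star_range h h1 h17))

/-- **Q_join(h²) below `2h(h²+1)`**: the body of `Stmt.stub_qjoinSharp` (pieces with exactly `h·h` states) holds for every
`h` and every `r ≤ (h+h)(h·h+1)`. -/
theorem qjoinSharp_of_le (h r : ℕ) (hr : r ≤ (h + h) * (h * h + 1)) :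
    ∃ (m : ℕ) (W : Fin m → ℕ) (wt : Fin m → Fin (h * h) → ℕ) (e : Fin r → Fin m × Finset (Fin (h * h))),
      m ≤ h + h ∧ Function.Injective e ∧
      (∀ x : Fin m × Finset (Fin (h * h)), x ∉ Set.range e →
        ∀ i, W (e i).1 + ∑ k ∈ (e i).2, wt (e i).1 k < W x.1 + ∑ k ∈ x.2, wt x.1 k) ∧
      ∀ u : Fin r → Finset (Fin h), Function.Injective u →
        ∃ tx : Fin m → Option (Fin (h * h)) → Fin h → ℂ,
          (Matrix.of fun i k : Fin r =>
            ∏ a ∈ u i, (tx (e k).1 none a + ∑ q ∈ (e k).2, tx (e k).1 (some q) a)).det ≠ 0 := by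
  obtain ⟨W, wt, e, he, hthr, hgood⟩ := starJoin_good h (h + h) (h * h) r hr
  exact ⟨h + h, W, wt, e, le_rfl, he, hthr, hgood⟩

/-- `2^h ≤ 2h(h²+1)` for `1 ≤ h ≤ 11` (and not for `h = 12`: `3480 < 4096`). -/
theorem two_pow_le_sharp_range (h : ℕ) (h1 : 1 ≤ h) (h11 : h ≤ 11) : 2 ^ h ≤ (h + h) * (h * h + 1) := by
  interval_cases h <;> norm_num

/-- **Q_join(h²) for `h ≤ 11`**: for `1 ≤ h ≤ 11` the body of `Stmt.stub_qjoinSharp` holds for every `r ≤ 2^h`; the first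
open window is `h = 12`, `r ∈ (3480, 4096]`. -/
theorem qjoinSharp_upto_eleven (h : ℕ) (h1 : 1 ≤ h) (h11 : h ≤ 11) (r : ℕ) (hr : r ≤ 2 ^ h) :
    ∃ (m : ℕ) (W : Fin m → ℕ) (wt : Fin m → Fin (h * h) → ℕ) (e : Fin r → Fin m × Finset (Fin (h * h))),
      m ≤ h + h ∧ Function.Injective e ∧
      (∀ x : Fin m × Finset (Fin (h * h)), x ∉ Set.range e →
        ∀ i, W (e i).1 + ∑ k ∈ (e i).2, wt (e i).1 k < W x.1 + ∑ k ∈ x.2, wt x.1 k) ∧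
      ∀ u : Fin r → Finset (Fin h), Function.Injective u →
        ∃ tx : Fin m → Option (Fin (h * h)) → Fin h → ℂ,
          (Matrix.of fun i k : Fin r =>
            ∏ a ∈ u i, (tx (e k).1 none a + ∑ q ∈ (e k).2, tx (e k).1 (some q) a)).det ≠ 0 :=
  qjoinSharp_of_le h r (hr.trans (two_pow_le_sharp_range h h1 h11))

/-- **The 2-skeleton lies inside the star range**: `|B₃(h)| = Σ_{j<4} C(h,j) ≤ (h+h)(h·h+1)` for `h ≥ 1`. So the witness
family of `TripleRank.not_ballGood_sq_hypothesis` (all sets of size ≤ 3), and anything of size `≤ 2h³+2h` (e.g. `B₄([h])`),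
is absorbed by star joins: no such family can refute `stub_qjoinSharp` or `stub_universalJoinWide`. -/
theorem twoSkeleton_within_star_range (h : ℕ) (h1 : 1 ≤ h) :
    ∑ j ∈ Finset.range 4, h.choose j ≤ (h + h) * (h * h + 1) := by
  have hc : ∀ j, h.choose j ≤ h ^ j := fun j => Nat.choose_le_pow h j
  simp only [Finset.sum_range_succ, Finset.sum_range_zero, zero_add]
  have hh2 : h ^ 2 ≤ h ^ 3 := Nat.pow_le_pow_right h1 (by norm_num)
  nlinarith [hc 0, hc 1, hc 2, hc 3]

end StarJoin

end

end Summit.ValiantsHypothesis.ValiantsHypothesis.Theorems.BarrierLever.HiddenStates
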